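import Summits.QuantumFields.BalabanUV.T4Continuum.Support.NE7SkewTorusForms
import Summits.QuantumFields.BalabanUV.T4Continuum.Support.NE7RestrictedOperator
import Summits.QuantumFields.BalabanUV.T4Continuum.Support.NE3SmoothRightInverseW
import Summits.QuantumFields.BalabanUV.T4Continuum.Support.AveragingDeficitMultiLevelBridge
import HarnessLib

/-!
# NE7StraightPartOperator — THE EXACT STRAIGHT PART OF THE LINEARISED k-FOLD AVERAGE AS AN OPERATOR ON THE SKEW TORUS 1-FORMS:
# `Sq η = resF N (M^d • Ad_{cavgIter W (z,κ)} (QbarIter L (j+2) W (extF η) (z,κ)))`, `M = L^{j+2}`, a continuous linear map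
# `Form d n (M·N) →L[ℝ] Form d n N` preserving skewness, whose kernel (on ANY form) forces `QbarIter … (extF η) = 0` — the operator `Sq` of
# `NE7TensionEnergyEnd`, so that the energy road's residual is the SINGLE inequality `‖Sq_r − S′_r‖ ≤ √λ′∕8` (the NE3 C1 tower in op-norm)

Cell `pub-balaban`, rung (B)+1 sub-cell t4, lineage `b2b-balaban-t4-ne7-p1`, generation 63 (CRUX PROVER NE7 #1, ruling e34b3e0c (2)); hunt (h7)
«ENERGY ROAD», identification step (h7-e), last piece.  INPUTS BY NAME: the NE3 swarm's tower `NE3TangentCovariantTower.QbarIter`, its additivity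
`NE3CovariantLineSumsTower.QbarIter_add` and homogeneity `NE3SmoothRightInverseW.QbarIter_smul` (multi-level small-field class), its periodicity
`NE3FramePotBoundW.isPeriodicDir_QbarIter`, one-level skewness `NE3TangentCovariantStructure.Qbar_skew`, and `cavgIter_unitary_small`.
CONTENT ([folklore]; 0 def, 0 sorry): §1 **`QbarIter_skew`** (induction through the tower); §2 **`exists_straightPart_clm`** (the CLM `Sq₀` on all
torus 1-forms, existence; the factor `M^d` and the conjugation by the averaged bond variable `cavgIter L (j+2) W (z,κ)` put it in the frame and
normalisation of the comb line sum `TWc`, cf. `NE3CombVsTowerEnd`); §3 **`straightPart_mem`** (skew in ⇒ skew out) and **`straightPart_ker`**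
(`Sq₀ η = 0 ⇒ QbarIter L (j+2) W (extF η) ≡ 0`: periodicity + `M^d ≠ 0` + `Ad` injective); §4 **`exists_straightPart_restrict`**: the restriction
`Sq : K_f →L[ℝ] K_c` to the skew forms with `(Sq b : Form) = Sq₀ b` and the kernel property in the exact shape of the hypothesis `hSq` of
`NE7TensionEnergyEnd.tension_energy_le_of_near_straightPart`.
WHAT REMAINS for (H∃)ᵀ after this file: the op-norm inequality `‖Sq − S′_r‖ ≤ δ`, `8δ ≤ √λ′` (NE3 `NE3CombVsTowerEnd.sum_norm_TWc_sub_Ad_QstrIter_sq_le`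
+ `NE3CovariantLineSumsL2TowerSharp.sqrt_l2sq_ErrIter_le_sharp`, relative size `(16d+20)·loopRad + 2KS·radSum∕ρ` against `√((M²+2)∕3M²) ≥ 1∕√3`, under a
class smallness a constant factor beyond `LevelSmall`), and interiority (8).
HONEST FRAMING (page 1): packaging of accepted tree theorems at ONE unitary background in the multi-level small-field class; nothing about Bałaban's
minimisers is proved here; NE7, NE3 NOT PRINTED in [Balaban1984PropagatorsI]–[Balaban1989LargeFieldII] and NOT PROVED; FIXED FINITE torus, rung
(B)+1; continuum YM on T⁴ ⇐ BetaPertH ∧ nine spine estimates (0/9 proved); BetaPertH ⇐ (D1) ∧ (D4) ∧ CAP+tail; G-an2-4 gates asym, D1 and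
NE2/3/4; NOT infinite volume, NOT mass gap, NOT Clay.  0 def, 0 sorry.
-/

set_option autoImplicit false

open scoped BigOperators InnerProductSpace Matrix Matrix.Norms.L2Operator
open Finset

namespace Summit.QuantumFields.BalabanUV.T4Continuum.NE7StraightPartOperator

open Literature.MathematicalPhysics.QuantumFieldTheory.Balaban1983to89
open B7Prop1Explicit B7Prop2Explicit MatrixNorms UnitaryModel
open T4AveragingDeficitWall (IsUnitaryCfg IsSkewDir SmallField Ad)
open T4AveragingDeficitWallBoundary (periodBox IsPeriodicCfg)
open T4AveragingDeficitNonAbelian (Ad_mul)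
open AveragingDeficitPeriodicCounting (IsPeriodicDir)
open AveragingDeficitNearIdentity (Ad_add Ad_real_smul Ad_zero Ad_one)
open AveragingDeficitTransport (Ad_mem_skewAdjoint)
open AveragingDeficitChartCalculus (cavg)
open AveragingDeficitMultiLevelPrep (cavgIter tower LevelSmall cavgIter_unitary_small isPeriodicCfg_cavgIter)
open AveragingDeficitMultiLevelBridge (tower_eq)
open NE3TangentCovariantStructure (Qbar Qbar_skew)
open NE3TangentCovariantTower (QbarIter QbarIter_succ step_small)
open NE3CovariantLineSumsTower (QbarIter_add)
open NE3SmoothRightInverseW (QbarIter_smul)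
open NE3FramePotBoundW (isPeriodicDir_QbarIter)
open NE3HilbertSchmidtTorus
open NE7SkewTorusForms (isSkewDir_extF_resF)
open NE7RestrictedOperator (exists_restrict)

noncomputable section

variable {d : ℕ} {n : Type*} [Fintype n] [DecidableEq n]

/-! ## §1 The tower of double-bar averages preserves skewness -/

/-- **`QbarIter` OF A SKEW DIRECTION IS SKEW** in the multi-level small-field class (the tree's one-level `Qbar_skew` through the tower). [folklore] -/
theorem QbarIter_skew [Nonempty n] {L : ℕ} (hL : 1 ≤ L) :
    ∀ (j : ℕ) {W : Site d → Fin d → (Matrix n n ℂ)ˣ} {x : ℝ}, IsUnitaryCfg W → 0 ≤ x → LevelSmall d L j x → SmallField W x →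
    ∀ {Y : Site d → Fin d → Matrix n n ℂ}, IsSkewDir Y → IsSkewDir (QbarIter L (j + 1) W Y) := by
  intro j
  induction j with
  | zero =>
      intro W x hWu hx hs hWx Y hY
      obtain ⟨h512, -, -, -⟩ := step_small hL hWu hx hs hWx
      rw [zero_add, NE3TangentCovariantTower.QbarIter_one]
      exact Qbar_skew hL hWu hx h512 hWx hY
  | succ j ih =>
      intro W x hWu hx hs hWx Y hY
      obtain ⟨h512, hW₁u, hr0, hW₁x⟩ := step_small hL hWu hx hs.1 hWx
      rw [QbarIter_succ]
      exact ih hW₁u hr0 hs.2 hW₁x (Qbar_skew hL hWu hx h512 hWx hY)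

/-! ## §2 The exact straight part as a continuous linear map on the torus 1-forms -/

/-- **THE EXACT STRAIGHT PART AS A CLM**: in the multi-level small-field class (`LevelSmall d L (j+1) x`, `SmallField W x`, unitary `W`) there is
`Sq₀ : Form d n (L^{j+2}·N) →L[ℝ] Form d n N` with `Sq₀ η = resF N (z κ ↦ (L^{j+2})^d • Ad_{cavgIter L (j+2) W z κ} (QbarIter L (j+2) W (extF η) z κ))`
(additivity `QbarIter_add`, homogeneity `QbarIter_smul` BY NAME). [folklore] -/
theorem exists_straightPart_clm [Nonempty n] {L N : ℕ} (hL : 1 ≤ L) (j : ℕ) [NeZero N] [NeZero (L ^ (j + 2) * N)]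
    {W : Site d → Fin d → (Matrix n n ℂ)ˣ} {x : ℝ} (hWu : IsUnitaryCfg W) (hx : 0 ≤ x) (hs : LevelSmall d L (j + 1) x) (hWx : SmallField W x) :
    ∃ Sq₀ : Form d n (L ^ (j + 2) * N) →L[ℝ] Form d n N, ∀ η : Form d n (L ^ (j + 2) * N),
      Sq₀ η = resF N (fun z κ => (((L ^ (j + 2) : ℕ) : ℝ) ^ d) •
        Ad (cavgIter L (j + 2) W z κ) (QbarIter L (j + 2) W (extF (L ^ (j + 2) * N) η) z κ)) := by
  let f : Form d n (L ^ (j + 2) * N) →ₗ[ℝ] Form d n N :=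
    { toFun := fun η => resF N (fun z κ => (((L ^ (j + 2) : ℕ) : ℝ) ^ d) •
        Ad (cavgIter L (j + 2) W z κ) (QbarIter L (j + 2) W (extF (L ^ (j + 2) * N) η) z κ))
      map_add' := fun a b => by
        have h : extF (L ^ (j + 2) * N) (a + b) = fun y μ => extF (L ^ (j + 2) * N) a y μ + extF (L ^ (j + 2) * N) b y μ := rfl
        have hadd := QbarIter_add hL (j + 1) hWu hx hs hWx (extF (L ^ (j + 2) * N) a) (extF (L ^ (j + 2) * N) b)
        rw [← resF_add]
        congr 1
        funext z κ
        have e := congrFun (congrFun hadd z) κ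
        rw [h]
        rw [show QbarIter L (j + 2) W (fun y μ => extF (L ^ (j + 2) * N) a y μ + extF (L ^ (j + 2) * N) b y μ) z κ
            = QbarIter L (j + 2) W (extF (L ^ (j + 2) * N) a) z κ + QbarIter L (j + 2) W (extF (L ^ (j + 2) * N) b) z κ from e,
          Ad_add, smul_add]
      map_smul' := fun t a => by
        have h : extF (L ^ (j + 2) * N) (t • a) = t • extF (L ^ (j + 2) * N) a := rfl
        have hsm := QbarIter_smul hL (j + 1) hWu hx hs hWx t (extF (L ^ (j + 2) * N) a)
        rw [RingHom.id_apply, ← NE7CombLineSumCoercive.resF_smul]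
        congr 1
        funext z κ
        have e : QbarIter L (j + 2) W (t • extF (L ^ (j + 2) * N) a) z κ = t • QbarIter L (j + 2) W (extF (L ^ (j + 2) * N) a) z κ :=
          congrFun (congrFun hsm z) κ
        rw [h, e, Ad_real_smul, smul_comm] }
  exact ⟨LinearMap.toContinuousLinearMap f, fun η => rfl⟩

/-! ## §3 Skewness is preserved; the kernel forces `QbarIter = 0` -/

/-- **`Sq₀` MAPS SKEW FORMS TO SKEW FORMS** (the averaged bond variables `cavgIter L (j+2) W` are unitary). [folklore] -/
theorem straightPart_mem [Nonempty n] {L N : ℕ} (hL : 1 ≤ L) (j : ℕ) [NeZero N] [NeZero (L ^ (j + 2) * N)]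
    {W : Site d → Fin d → (Matrix n n ℂ)ˣ} {x : ℝ} (hWu : IsUnitaryCfg W) (hx : 0 ≤ x) (hs : LevelSmall d L (j + 1) x) (hWx : SmallField W x)
    {Kf : Submodule ℝ (Form d n (L ^ (j + 2) * N))} (hKf : ∀ b : Form d n (L ^ (j + 2) * N), b ∈ Kf ↔ IsSkewDir (extF (L ^ (j + 2) * N) b))
    {Kc : Submodule ℝ (Form d n N)} (hKc : ∀ b : Form d n N, b ∈ Kc ↔ IsSkewDir (extF N b))
    (Sq₀ : Form d n (L ^ (j + 2) * N) →L[ℝ] Form d n N)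
    (hSq₀ : ∀ η : Form d n (L ^ (j + 2) * N), Sq₀ η = resF N (fun z κ => (((L ^ (j + 2) : ℕ) : ℝ) ^ d) •
        Ad (cavgIter L (j + 2) W z κ) (QbarIter L (j + 2) W (extF (L ^ (j + 2) * N) η) z κ))) :
    ∀ b ∈ Kf, Sq₀ b ∈ Kc := by
  intro b hb
  rw [hSq₀ b, hKc]
  obtain ⟨hVu, -, -⟩ := cavgIter_unitary_small hL (j + 1) hWu hx hs hWx
  refine isSkewDir_extF_resF N fun z κ => skewAdjoint.smul_mem _ ?_
  exact Ad_mem_skewAdjoint (hVu z κ) (QbarIter_skew hL (j + 1) hWu hx hs hWx ((hKf b).mp hb) z κ)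

/-- **THE KERNEL OF `Sq₀` FORCES `QbarIter (extF η) ≡ 0`** (for `W` of period `L^{j+2}·N`: the coarse field is `N`-periodic, `(L^{j+2})^d ≠ 0`, `Ad` is
injective). [folklore] -/
theorem straightPart_ker [Nonempty n] {L N : ℕ} (hL : 1 ≤ L) (j : ℕ) [NeZero N] [NeZero (L ^ (j + 2) * N)]
    {W : Site d → Fin d → (Matrix n n ℂ)ˣ} (hWP : IsPeriodicCfg W ((L ^ (j + 2) * N : ℕ) : ℤ))
    (Sq₀ : Form d n (L ^ (j + 2) * N) →L[ℝ] Form d n N)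
    (hSq₀ : ∀ η : Form d n (L ^ (j + 2) * N), Sq₀ η = resF N (fun z κ => (((L ^ (j + 2) : ℕ) : ℝ) ^ d) •
        Ad (cavgIter L (j + 2) W z κ) (QbarIter L (j + 2) W (extF (L ^ (j + 2) * N) η) z κ)))
    {η : Form d n (L ^ (j + 2) * N)} (hη : Sq₀ η = 0) :
    ∀ (z : Site d) (κ : Fin d), QbarIter L (j + 2) W (extF (L ^ (j + 2) * N) η) z κ = 0 := by
  -- periodicity of the coarse field
  have htow : ((tower L N (j + 2) : ℕ) : ℤ) = ((L ^ (j + 2) * N : ℕ) : ℤ) := by rw [tower_eq, Nat.mul_comm]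
  have hWP' : IsPeriodicCfg W ((tower L N (j + 2) : ℕ) : ℤ) := by rw [htow]; exact hWP
  have hηP : IsPeriodicDir (extF (L ^ (j + 2) * N) η) ((tower L N (j + 2) : ℕ) : ℤ) := by rw [htow]; exact isPeriodicDir_extF _ η
  have hQP : IsPeriodicDir (QbarIter L (j + 2) W (extF (L ^ (j + 2) * N) η)) (N : ℤ) := isPeriodicDir_QbarIter L N (j + 2) hWP' hηP
  have hVP : IsPeriodicCfg (cavgIter L (j + 2) W) (N : ℤ) := isPeriodicCfg_cavgIter L N (j + 2) hWP'
  have hFP : IsPeriodicDir (fun z κ => (((L ^ (j + 2) : ℕ) : ℝ) ^ d) •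
      Ad (cavgIter L (j + 2) W z κ) (QbarIter L (j + 2) W (extF (L ^ (j + 2) * N) η) z κ)) (N : ℤ) := by
    intro z i κ
    simp only [hVP z i κ, hQP z i κ]
  -- the field vanishes everywhere
  intro z κ
  have h0 : extF N (Sq₀ η) z κ = 0 := by
    rw [hη]
    show HSMat.ofHS ((0 : Form d n N) (AveragingDeficitTorusChart.redN N z, κ)) = 0
    rfl
  rw [hSq₀ η, extF_resF N hFP] at h0
  have hM1 : (0 : ℝ) < ((L ^ (j + 2) : ℕ) : ℝ) := by exact_mod_cast Nat.one_le_pow _ _ hL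
  have hM : (((L ^ (j + 2) : ℕ) : ℝ) ^ d) ≠ 0 := pow_ne_zero _ hM1.ne'
  have h1 : Ad (cavgIter L (j + 2) W z κ) (QbarIter L (j + 2) W (extF (L ^ (j + 2) * N) η) z κ) = 0 :=
    (smul_eq_zero.mp h0).resolve_left hM
  have h2 := congrArg (Ad (cavgIter L (j + 2) W z κ)⁻¹) h1
  rwa [← Ad_mul, inv_mul_cancel, Ad_one, Ad_zero] at h2

/-! ## §4 The restriction to the skew forms, in the shape consumed by `NE7TensionEnergyEnd` -/

/-- **THE OPERATOR `Sq` OF THE ENERGY ROAD'S END**: in the multi-level small-field class at a unitary `(L^{j+2}·N)`-periodic `W`, there are the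
straight-part CLM `Sq₀` and its restriction `Sq : K_f →L[ℝ] K_c` to the skew torus 1-forms, with `(Sq b : Form) = Sq₀ b` and the kernel property
`Sq b = 0 ⇒ QbarIter L (j+2) W (extF b) ≡ 0` — hypothesis `hSq` of `NE7TensionEnergyEnd.tension_energy_le_of_near_straightPart`. [folklore] -/
theorem exists_straightPart_restrict [Nonempty n] {L N : ℕ} (hL : 1 ≤ L) (j : ℕ) [NeZero N] [NeZero (L ^ (j + 2) * N)]
    {W : Site d → Fin d → (Matrix n n ℂ)ˣ} {x : ℝ} (hWu : IsUnitaryCfg W) (hWP : IsPeriodicCfg W ((L ^ (j + 2) * N : ℕ) : ℤ)) (hx : 0 ≤ x)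
    (hs : LevelSmall d L (j + 1) x) (hWx : SmallField W x)
    {Kf : Submodule ℝ (Form d n (L ^ (j + 2) * N))} (hKf : ∀ b : Form d n (L ^ (j + 2) * N), b ∈ Kf ↔ IsSkewDir (extF (L ^ (j + 2) * N) b))
    {Kc : Submodule ℝ (Form d n N)} (hKc : ∀ b : Form d n N, b ∈ Kc ↔ IsSkewDir (extF N b)) :
    ∃ Sq₀ : Form d n (L ^ (j + 2) * N) →L[ℝ] Form d n N, ∃ Sq : Kf →L[ℝ] Kc,
      (∀ η : Form d n (L ^ (j + 2) * N), Sq₀ η = resF N (fun z κ => (((L ^ (j + 2) : ℕ) : ℝ) ^ d) •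
        Ad (cavgIter L (j + 2) W z κ) (QbarIter L (j + 2) W (extF (L ^ (j + 2) * N) η) z κ))) ∧
      (∀ b : Kf, (Sq b : Form d n N) = Sq₀ (b : Form d n (L ^ (j + 2) * N))) ∧
      (∀ b : Kf, Sq b = 0 → ∀ (z : Site d) (κ : Fin d), QbarIter L (j + 2) W (extF (L ^ (j + 2) * N) (b : Form d n (L ^ (j + 2) * N))) z κ = 0) := by
  obtain ⟨Sq₀, hSq₀⟩ := exists_straightPart_clm (N := N) hL j hWu hx hs hWx
  obtain ⟨Sq, hSq⟩ := exists_restrict Sq₀ Kf Kc (straightPart_mem hL j hWu hx hs hWx hKf hKc Sq₀ hSq₀)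
  refine ⟨Sq₀, Sq, hSq₀, hSq, fun b hb => straightPart_ker hL j hWP Sq₀ hSq₀ ?_⟩
  have h := hSq b
  rw [hb, Submodule.coe_zero] at h
  exact h.symm

end

end Summit.QuantumFields.BalabanUV.T4Continuum.NE7StraightPartOperator
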